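import Literature.Analysis.FluidPDE.SpaceTimeRescaling

/-!
# Seregin 2023/2026: the Euler-scaling zoom at a potential Type II singularity — the scaling, the
# limit's scaled local-energy class, and the energy Liouville case

Reproduction (definitions + the elementary proved case) from
G. Seregin, *Remarks on Type II blowups of solutions to the Navier–Stokes equations*,
arXiv:2304.04045 (2023) [Seregin2023], and G. Seregin, *On potential Type II blowups for the
Navier–Stokes equations*, arXiv:2606.29468 (2026) [Seregin2026]. Page numbers are arXiv PDF pages.
Filed by the solo seat `solo-NavierStokesRegularity-informed` (session 6) as the typed object behind
its paper §3.2 ("door (γ) for Type II"); nothing here is new mathematics and nothing here bears on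
regularity.

## What is reproduced

* [Seregin2023] §2 p. 7: the **Euler scaling** `v^{λ,α}(y,τ) = λ^α v(λy, λ^{α+1}τ)`,
  `q^{λ,α}(y,τ) = λ^{2α} q(λy, λ^{α+1}τ)` (`α > 1`), under which the Euler equations are invariant
  while the viscous term of Navier–Stokes acquires the factor `λ^{α-1} → 0` ((2.3) p. 7), so that
  zoom limits at a Type II point solve Euler — `eulerZoom`, `eulerZoomPressure`.
* [Seregin2023] (1.10) p. 5: the exponents `m = 2 - α`, `m₁ = 2m - 1` — `sereginM`, `sereginM₁`,
  with `m₁ = 3 - 2α` (`sereginM₁_eq`).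
* The energy bookkeeping of the zoom (why `m₁`): `∫ |v^{λ,α}(y,τ)|² dy = λ^{2α-n} ∫ |v(x,λ^{α+1}τ)|² dx`
  in dimension `n` (`lintegral_eulerZoom_enorm_sq`, ball version `setLIntegral_ball_eulerZoom_enorm_sq`),
  hence the `m₁`-scaled local energy `a^{-m₁} ∫_{B(a)} |u(y,s)|² dy` of (1.9)/(1.13) is exactly
  covariant under the zoom when `m₁ = n - 2α` (`= 3 - 2α` on `ℝ³`) — `scaledLocalEnergy_eulerZoom`.
* The first clause of the limit class, [Seregin2023] (1.13) p. 5–6 = [Seregin2026] (3.5) p. 9 with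
  `F(a) = a^{α-1}`: `sup_{a>0} sup_{-a²<s<0} a^{-m₁} ∫_{B(a)} |u(y,s)|² dy ≤ c` —
  `HasScaledLocalEnergyBound`.
* The elementary Liouville theorem [Seregin2023] §3 p. 10 ("if `m₁ < 0` which means that `m < 1/2`,
  then, sending `a → ∞`, we conclude that `u = 0`") = the restriction [Seregin2026] (3.11) p. 10
  ("`u = 0` if `2α - 3 > 0` … we have to restrict ourselves to the case `2α - 3 ≤ 0`") —
  `lintegral_enorm_sq_eq_zero_of_scaledLocalEnergyBound`, `ae_eq_zero_of_scaledLocalEnergyBound`.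
* Bookkeeping only (not a statement of either paper): with the collapse rate `b = 1/(α+1)` of an
  `α`-asymptotically self-similar blow-up `(T-t)^{-α/(α+1)} U(x/(T-t)^{1/(α+1)})` — the `α` of
  [ChaeShvydkoy2013] — Seregin's non-trivial range `1/2 ≤ m < 1` reads `1 < α ≤ 3/2`, i.e.
  `2/5 ≤ b < 1/2`: `sereginM_lt_one_iff`, `half_le_sereginM_iff`, `sereginM₁_nonneg_iff`,
  `rateOfAlpha_lt_half_iff`, `twoFifths_le_rateOfAlpha_iff`.

## Deliberately not here

Proposition 1.2 of [Seregin2023] and Theorems 2.1 / 3.1 of [Seregin2026] themselves (compactness of the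
Euler zooms under the scenario (1.8)–(1.9), resp. (3.1)–(3.3), with a non-trivial ancient suitable weak
Euler solution as the limit): a faithful typing needs the scenario quantities `M^{s,l}_κ`, `A_{m₁}`,
`D_m`, `E_m` over suitable weak solutions in the unit parabolic cylinder, which this file does not set
up. Also not here: the irrotational case (§3 p. 11), the self-similar Liouville theorem Prop. 5.1
(p. 15), Appendix I, and the axisymmetric conservation law Prop. 4.1 of [Seregin2026].
-/

noncomputable section

open _root_.MeasureTheory _root_.Set _root_.Filter _root_.Metric _root_.Module
open scoped _root_.ENNReal _root_.Topology

namespace Literature.Analysis.FluidPDE.Seregin2023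

variable {E : Type*} [NormedAddCommGroup E] [InnerProductSpace ℝ E]
  {F : Type*} [NormedAddCommGroup F] [NormedSpace ℝ F]

/-! ## The Euler scaling ([Seregin2023] §2) -/

/-- The **Euler scaling** of a velocity field `v : time → space → F` with exponent `α` and parameter
`l > 0`: `eulerZoom α l v τ y = l^α • v (l^(α+1) τ) (l • y)`, i.e. `v^{λ,α}(y,τ) = λ^α v(x,t)` with
`x = λy`, `t = λ^{α+1}τ`. The Euler equations are invariant under it; for `α = 1` it is the
Navier–Stokes scaling. [cite: Seregin2023, §2 (p. 7)] -/
def eulerZoom (α l : ℝ) (v : ℝ → E → F) (τ : ℝ) (y : E) : F :=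
  (l ^ α) • v (l ^ (α + 1) * τ) (l • y)

/-- The Euler scaling of the pressure: `q^{λ,α}(y,τ) = λ^{2α} q(λy, λ^{α+1}τ)`.
[cite: Seregin2023, §2 (p. 7)] -/
def eulerZoomPressure (α l : ℝ) (q : ℝ → E → ℝ) (τ : ℝ) (y : E) : ℝ :=
  l ^ (2 * α) * q (l ^ (α + 1) * τ) (l • y)

/-- Unfolding lemma for `eulerZoom`. [cite: Seregin2023, §2 (p. 7)] -/
theorem eulerZoom_apply (α l : ℝ) (v : ℝ → E → F) (τ : ℝ) (y : E) :
    eulerZoom α l v τ y = (l ^ α) • v (l ^ (α + 1) * τ) (l • y) := rfl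

/-- Unfolding lemma for `eulerZoomPressure`. [cite: Seregin2023, §2 (p. 7)] -/
theorem eulerZoomPressure_apply (α l : ℝ) (q : ℝ → E → ℝ) (τ : ℝ) (y : E) :
    eulerZoomPressure α l q τ y = l ^ (2 * α) * q (l ^ (α + 1) * τ) (l • y) := rfl

/-- At `l = 1` the Euler scaling is the identity. [folklore] -/
theorem eulerZoom_one (α : ℝ) (v : ℝ → E → F) : eulerZoom α 1 v = v := by
  funext τ y
  simp [eulerZoom]

/-! ## The exponents `m`, `m₁` ([Seregin2023] (1.10)) and the collapse rate `b = 1/(α+1)` -/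

/-- Seregin's exponent `m = 2 - α` ((1.10) p. 5): the CKN quantities `D_m`, `E_m` of the scenario
(1.9) are rescaled by `r^{-2m}`, `r^{-m}`. [cite: Seregin2023, (1.10) (p. 5)] -/
def sereginM (α : ℝ) : ℝ := 2 - α

/-- Seregin's exponent `m₁ = 2m - 1` ((1.10) p. 5): the local energy `A_{m₁}` of the scenario (1.9)
and of the limit class (1.13) is rescaled by `r^{-m₁}`. [cite: Seregin2023, (1.10) (p. 5)] -/
def sereginM₁ (α : ℝ) : ℝ := 2 * sereginM α - 1

/-- `m₁ = 3 - 2α`. [cite: Seregin2023, (1.10) (p. 5)] -/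
theorem sereginM₁_eq (α : ℝ) : sereginM₁ α = 3 - 2 * α := by
  simp only [sereginM₁, sereginM]
  ring

/-- The energy exponent of the Euler zoom on `ℝ³` is `2α - 3 = -m₁` (cf. [Seregin2026] (3.10)–(3.11):
`F²(a)/a = a^{2α-3}`). [cite: Seregin2026, (3.10)–(3.11) (p. 10)] -/
theorem two_mul_sub_three_eq_neg_sereginM₁ (α : ℝ) : 2 * α - 3 = -sereginM₁ α := by
  rw [sereginM₁_eq]
  ring

/-- `m < 1 ↔ α > 1` (the Type II side: zoom exponent above the Navier–Stokes one). [folklore] -/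
theorem sereginM_lt_one_iff (α : ℝ) : sereginM α < 1 ↔ 1 < α := by
  simp only [sereginM]
  constructor <;> intro h <;> linarith

/-- `1/2 ≤ m ↔ α ≤ 3/2`: Seregin's non-trivial range `m ≥ 1/2` ([Seregin2023] §3 p. 10) is
`α ≤ 3/2`. [cite: Seregin2023, §3 (p. 10)] -/
theorem half_le_sereginM_iff (α : ℝ) : 1 / 2 ≤ sereginM α ↔ α ≤ 3 / 2 := by
  simp only [sereginM]
  constructor <;> intro h <;> linarith

/-- `0 ≤ m₁ ↔ α ≤ 3/2` — equivalently the energy exponent `2α - 3 ≤ 0` ([Seregin2026] (3.11)).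
[cite: Seregin2026, (3.11) (p. 10)] -/
theorem sereginM₁_nonneg_iff (α : ℝ) : 0 ≤ sereginM₁ α ↔ α ≤ 3 / 2 := by
  rw [sereginM₁_eq]
  constructor <;> intro h <;> linarith

/-- The **collapse rate** `b = 1/(α+1)` of an `α`-asymptotically self-similar blow-up
`v(x,t) ≈ (T-t)^{-α/(α+1)} U(x/(T-t)^{1/(α+1)})`, the fields left invariant by `eulerZoom α`
(Chae–Shvydkoy's `α`; `b = 1/2` is Leray's rate). Bookkeeping definition. [folklore] -/
def rateOfAlpha (α : ℝ) : ℝ := 1 / (α + 1)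

/-- `b < 1/2 ↔ α > 1` (for `α > -1`): Euler zooms with `α > 1` see collapse faster than Leray's
rate. [folklore] -/
theorem rateOfAlpha_lt_half_iff {α : ℝ} (hα : -1 < α) : rateOfAlpha α < 1 / 2 ↔ 1 < α := by
  have h : 0 < α + 1 := by linarith
  simp only [rateOfAlpha]
  rw [div_lt_iff₀ h]
  constructor <;> intro h' <;> linarith

/-- `2/5 ≤ b ↔ α ≤ 3/2` (for `α > -1`): Seregin's non-trivial range `m ≥ 1/2` is the finite-energy
range `α ≤ N/2 = 3/2` of [ChaeShvydkoy2013], i.e. collapse rates `b ≥ 2/5`.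
[cite: ChaeShvydkoy2013, p. 3 and Thm. 3.1] -/
theorem twoFifths_le_rateOfAlpha_iff {α : ℝ} (hα : -1 < α) : 2 / 5 ≤ rateOfAlpha α ↔ α ≤ 3 / 2 := by
  have h : 0 < α + 1 := by linarith
  simp only [rateOfAlpha]
  rw [le_div_iff₀ h]
  constructor <;> intro h' <;> linarith

/-! ## Energy bookkeeping of the zoom -/

/-- Exponent algebra: `(l^α)² · (lⁿ)⁻¹ = l^{2α - n}` for `l > 0`. [folklore] -/
private theorem rpow_sq_mul_inv_pow {l : ℝ} (hl : 0 < l) (α : ℝ) (n : ℕ) :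
    (l ^ α) ^ 2 * (l ^ n)⁻¹ = l ^ (2 * α - n) := by
  rw [← Real.rpow_natCast (l ^ α) 2, ← Real.rpow_natCast l n, ← Real.rpow_mul hl.le,
    ← Real.rpow_neg hl.le, ← Real.rpow_add hl]
  congr 1
  push_cast
  ring

variable [FiniteDimensional ℝ E] [MeasurableSpace E] [BorelSpace E]

/-- **Energy of the Euler zoom**: `∫ |v^{λ,α}(y,τ)|² dy = λ^{2α-n} ∫ |v(x, λ^{α+1}τ)|² dx`,
`n = dim E` — amplitude squared `λ^{2α}` times the Jacobian `λ^{-n}` of `y ↦ λy`. On `ℝ³` the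
exponent is `2α - 3 = -m₁`: positive (zoom energies → 0, the limit is killed) iff `α > 3/2`, zero at
`α = 3/2`, negative (an energy bound is invisible to the limit) iff `α < 3/2`. [folklore] -/
theorem lintegral_eulerZoom_enorm_sq {α l : ℝ} (hl : 0 < l) (v : ℝ → E → F) (τ : ℝ) :
    ∫⁻ y, ‖eulerZoom α l v τ y‖ₑ ^ 2 =
      ENNReal.ofReal (l ^ (2 * α - finrank ℝ E)) * ∫⁻ x, ‖v (l ^ (α + 1) * τ) x‖ₑ ^ 2 := by
  have key : ∫⁻ y, ‖v (l ^ (α + 1) * τ) ((0 : E) + l • y)‖ₑ ^ 2 =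
      ENNReal.ofReal (l ^ finrank ℝ E)⁻¹ * ∫⁻ x, ‖v (l ^ (α + 1) * τ) x‖ₑ ^ 2 :=
    lintegral_comp_space_affine hl 0 (fun x => ‖v (l ^ (α + 1) * τ) x‖ₑ ^ 2)
  simp only [zero_add] at key
  simp only [eulerZoom, enorm_smul, mul_pow]
  rw [lintegral_const_mul' _ _ (ENNReal.pow_ne_top enorm_ne_top), key, ← mul_assoc,
    Real.enorm_eq_ofReal (Real.rpow_nonneg hl.le _),
    ← ENNReal.ofReal_pow (Real.rpow_nonneg hl.le _), ← ENNReal.ofReal_mul (sq_nonneg _),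
    rpow_sq_mul_inv_pow hl]

omit [FiniteDimensional ℝ E] [MeasurableSpace E] [BorelSpace E] in
/-- The dilation `y ↦ l • y` (`l > 0`) pulls the ball `B(0, l a)` back to `B(0, a)`. [folklore] -/
theorem preimage_smul_ball {l : ℝ} (hl : 0 < l) (a : ℝ) :
    (fun y : E => (0 : E) + l • y) ⁻¹' ball (0 : E) (l * a) = ball 0 a := by
  ext y
  simp only [mem_preimage, zero_add, mem_ball_zero_iff, norm_smul, Real.norm_eq_abs, abs_of_pos hl]
  exact ⟨fun h => lt_of_mul_lt_mul_left h hl.le, fun h => mul_lt_mul_of_pos_left h hl⟩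

/-- **Local energy of the Euler zoom**: `∫_{B(a)} |v^{λ,α}(y,τ)|² dy = λ^{2α-n} ∫_{B(λa)} |v(x,λ^{α+1}τ)|² dx`.
[folklore] -/
theorem setLIntegral_ball_eulerZoom_enorm_sq {α l : ℝ} (hl : 0 < l) (v : ℝ → E → F) (τ a : ℝ) :
    ∫⁻ y in ball (0 : E) a, ‖eulerZoom α l v τ y‖ₑ ^ 2 =
      ENNReal.ofReal (l ^ (2 * α - finrank ℝ E)) *
        ∫⁻ x in ball (0 : E) (l * a), ‖v (l ^ (α + 1) * τ) x‖ₑ ^ 2 := by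
  have key := setLIntegral_preimage_comp_space_affine hl (0 : E)
    (fun x => ‖v (l ^ (α + 1) * τ) x‖ₑ ^ 2) (ball (0 : E) (l * a))
  rw [preimage_smul_ball hl] at key
  simp only [zero_add] at key
  simp only [eulerZoom, enorm_smul, mul_pow]
  rw [lintegral_const_mul' _ _ (ENNReal.pow_ne_top enorm_ne_top), key, ← mul_assoc,
    Real.enorm_eq_ofReal (Real.rpow_nonneg hl.le _),
    ← ENNReal.ofReal_pow (Real.rpow_nonneg hl.le _), ← ENNReal.ofReal_mul (sq_nonneg _),
    rpow_sq_mul_inv_pow hl]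

/-- The **`m₁`-scaled local energy** of a time slice, `a^{-m₁} ∫_{B(a)} |u(y,s)|² dy` — the quantity
inside `A_{m₁}` of the scenario (1.9) and of the limit class (1.13).
[cite: Seregin2023, (1.9) and (1.13) (pp. 4–6)] -/
def scaledLocalEnergy (m₁ : ℝ) (u : ℝ → E → F) (s a : ℝ) : ℝ≥0∞ :=
  ENNReal.ofReal (a ^ (-m₁)) * ∫⁻ y in ball (0 : E) a, ‖u s y‖ₑ ^ 2

/-- **Why `m₁ = 3 - 2α`**: the `m₁`-scaled local energy is exactly covariant under the Euler zoom,
`(scaled energy of v^{λ,α} at time τ, radius a) = (scaled energy of v at time λ^{α+1}τ, radius λa)`,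
precisely when `m₁ = n - 2α` (`n = dim E`; `3 - 2α = 2m - 1` on `ℝ³`, (1.10)). So a bound on
`A_{m₁}` is the scale-covariant information the zoom limit inherits. [folklore] -/
theorem scaledLocalEnergy_eulerZoom {α l m₁ : ℝ} (hl : 0 < l) (hm₁ : m₁ = finrank ℝ E - 2 * α)
    (v : ℝ → E → F) (τ : ℝ) {a : ℝ} (ha : 0 < a) :
    scaledLocalEnergy m₁ (eulerZoom α l v) τ a =
      scaledLocalEnergy m₁ v (l ^ (α + 1) * τ) (l * a) := by
  simp only [scaledLocalEnergy, setLIntegral_ball_eulerZoom_enorm_sq hl, ← mul_assoc]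
  congr 1
  rw [← ENNReal.ofReal_mul (Real.rpow_nonneg ha.le _), Real.mul_rpow hl.le ha.le, hm₁]
  congr 1
  have h1 : (2 : ℝ) * α - (finrank ℝ E : ℝ) = -((finrank ℝ E : ℝ) - 2 * α) := by ring
  rw [h1]
  ring

/-! ## The limit class (1.13) and the energy Liouville case ([Seregin2023] §3) -/

/-- **Scaled local-energy bound** — the first clause of the limit class (1.13) of [Seregin2023]
(= (3.5) of [Seregin2026] with `F(a) = a^{α-1}`): for a field `u` on `E × (-∞, 0)`,
`sup_{a>0} sup_{-a²<s<0} a^{-m₁} ∫_{B(a)} |u(y,s)|² dy ≤ c`, written as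
`∫_{B(a)} |u(·,s)|² ≤ c · a^{m₁}` for all `a > 0`, `-a² < s < 0`.
[cite: Seregin2023, (1.13) (pp. 5–6)] -/
def HasScaledLocalEnergyBound (m₁ c : ℝ) (u : ℝ → E → F) : Prop :=
  ∀ a : ℝ, 0 < a → ∀ s ∈ Ioo (-(a ^ 2)) 0,
    ∫⁻ y in ball (0 : E) a, ‖u s y‖ₑ ^ 2 ≤ ENNReal.ofReal (c * a ^ m₁)

omit [NormedSpace ℝ F] in
/-- **Energy Liouville case** ([Seregin2023] §3 p. 10; [Seregin2026] (3.11)): if `m₁ < 0` — i.e.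
`m < 1/2`, `α > 3/2`, the energy exponent `2α - 3` of the zoom is positive — then every field in the
class `HasScaledLocalEnergyBound m₁ c` has `∫ |u(y,s)|² dy = 0` for every `s < 0`: for fixed `s` and
`R`, `∫_{B(R)} |u(·,s)|² ≤ ∫_{B(a)} |u(·,s)|² ≤ c a^{m₁} → 0` as `a → ∞`. Hence Type II
singularities of the scenario (1.8)–(1.9) with `m < 1/2` cannot occur. [cite: Seregin2023, §3 (p. 10)] -/
theorem lintegral_enorm_sq_eq_zero_of_scaledLocalEnergyBound {m₁ c : ℝ} (hm : m₁ < 0)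
    {u : ℝ → E → F} (hu : HasScaledLocalEnergyBound m₁ c u) {s : ℝ} (hs : s < 0) :
    ∫⁻ y, ‖u s y‖ₑ ^ 2 = 0 := by
  -- the transported bound tends to zero
  have hlim : Tendsto (fun a : ℝ => ENNReal.ofReal (c * a ^ m₁)) atTop (𝓝 0) := by
    have h1 : Tendsto (fun a : ℝ => a ^ m₁) atTop (𝓝 0) := by
      have h := tendsto_rpow_neg_atTop (neg_pos.2 hm)
      simpa using h
    have h2 := h1.const_mul c
    rw [mul_zero] at h2
    have h3 := ENNReal.tendsto_ofReal h2
    rwa [ENNReal.ofReal_zero] at h3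
  -- every ball integral at time `s` vanishes once `-R² < s`
  have hball : ∀ R : ℝ, 0 < R → -(R ^ 2) < s → ∫⁻ y in ball (0 : E) R, ‖u s y‖ₑ ^ 2 = 0 := by
    intro R hR hRs
    refine le_antisymm (ge_of_tendsto hlim ?_) bot_le
    filter_upwards [eventually_ge_atTop R] with a ha
    have ha0 : 0 < a := hR.trans_le ha
    have hsa : s ∈ Ioo (-(a ^ 2)) 0 := ⟨by nlinarith, hs⟩
    calc ∫⁻ y in ball (0 : E) R, ‖u s y‖ₑ ^ 2
        ≤ ∫⁻ y in ball (0 : E) a, ‖u s y‖ₑ ^ 2 := lintegral_mono_set (ball_subset_ball ha)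
      _ ≤ ENNReal.ofReal (c * a ^ m₁) := hu a ha0 s hsa
  -- exhaust the space by the balls `B(0, n + R₀)`
  obtain ⟨R₀, hR₀, hR₀s⟩ : ∃ R₀ : ℝ, 0 < R₀ ∧ -(R₀ ^ 2) < s := by
    refine ⟨Real.sqrt (-s) + 1, by positivity, ?_⟩
    have h0 : 0 ≤ Real.sqrt (-s) := Real.sqrt_nonneg _
    have h1 : Real.sqrt (-s) ^ 2 = -s := Real.sq_sqrt (by linarith)
    nlinarith
  have hU : (⋃ n : ℕ, ball (0 : E) (n + R₀)) = univ := by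
    refine eq_univ_of_forall fun y => ?_
    obtain ⟨n, hn⟩ := exists_nat_gt ‖y‖
    refine mem_iUnion.2 ⟨n, ?_⟩
    rw [mem_ball_zero_iff]
    linarith
  rw [← setLIntegral_univ, ← hU]
  refine le_antisymm ((lintegral_iUnion_le _ _).trans (le_of_eq ?_)) bot_le
  refine ENNReal.tsum_eq_zero.2 fun n => hball _ (by positivity) (lt_of_le_of_lt ?_ hR₀s)
  have hn : (0 : ℝ) ≤ n := n.cast_nonneg
  nlinarith

omit [NormedSpace ℝ F] in
/-- **Energy Liouville case, a.e. form**: under `m₁ < 0`, a (strongly measurable) time slice of a field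
in the class (1.13) vanishes almost everywhere — "`u = 0`" of [Seregin2023] §3 p. 10.
[cite: Seregin2023, §3 (p. 10)] -/
theorem ae_eq_zero_of_scaledLocalEnergyBound {m₁ c : ℝ} (hm : m₁ < 0) {u : ℝ → E → F}
    (hu : HasScaledLocalEnergyBound m₁ c u) {s : ℝ} (hs : s < 0)
    (hmeas : AEStronglyMeasurable (u s) volume) : u s =ᵐ[volume] 0 := by
  have h0 := lintegral_enorm_sq_eq_zero_of_scaledLocalEnergyBound hm hu hs
  have hae : (fun y => ‖u s y‖ₑ ^ 2) =ᵐ[volume] 0 :=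
    (lintegral_eq_zero_iff' (hmeas.enorm.pow_const 2)).1 h0
  filter_upwards [hae] with y hy
  have hy' : ‖u s y‖ₑ ^ 2 = 0 := hy
  rwa [pow_eq_zero_iff two_ne_zero, enorm_eq_zero] at hy'

end Literature.Analysis.FluidPDE.Seregin2023

end
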